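import Summits.BirchSwinnertonDyer.BirchSwinnertonDyer.Theorems.PrintCf2SplitBadTwoLocalPowersAtV
import HarnessLib

/-!
# Crux `PrintCf2.SplitBadTwoRankOneOfFacts` (stmt-BirchSwinnertonDyer-20368), S3n′-FACT-FREE road, brick R2/B4c = (P), CONVERSE:
# EVERY CONJUGATE `ι_v ∘ σ` OF THE CHOSEN EMBEDDING CUTS OUT SOME PLACE `w ∣ v` — so «`x ∈ (F_w)ⁿ` for all `w ∣ v`» ⟺
# «Kummer coboundary on `θ_v⁻¹(σ·Gal(K̄/F)·σ⁻¹)` for all `σ ∈ Γ_K`»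

Cell `bsd-print-cf2`, WIDTH seat `bsd-line-cf2-p1-w6` g6 (prover-bsd-line-cf2-p1-w6-g6-0); `--supports stmt-BirchSwinnertonDyer-20368` (helper,
Theses-free). HONEST FRAMING: number-field plumbing; nothing here closes the crux or a registered stub; BSD is not proved by any of this; no summit
statement is proved by this seat. No definition, no named fact, no instance, no `sorry`.

Sequel of `PrintCf2SplitBadTwoLocalPowersAtV` (§4 there: ∀ `w ∣ v` ∃ `σ`). Here the converse direction of Neukirch II (8.1)–(8.3) «places of `F` above
`v` ↔ `K`-embeddings `F → K̄_v` modulo `Γ_{K_v}`»: for every `σ ∈ Γ_K` the `K`-embedding `ι_v ∘ σ|_F` extends `K_v`-linearly to `F ⊗[K] K_v`, hence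
(Cassels–Fröhlich II (10.2): `F ⊗[K] K_v ≅ ∏_{w∣v} F_w`, the tree's FLT packet `baseChangeAlgEquiv`) to a ring map `Ψ : ∏_{w∣v} F_w → K̄_v`; a ring
map from a finite product of fields to a field kills all but ONE of the orthogonal idempotents `ε_w`, and `t ↦ Ψ(ε_{w₀}·t)` is the wanted
`K_v`-embedding `e : F_{w₀} →ₐ[K_v] K̄_v` with `e x = ι_v(σ•x)` on `F`.

* §1 `exists_eq_one_of_sum_idempotents` — pure algebra: orthogonal idempotents summing to `1` in a domain: exactly one image is `1`.
* §2 **`exists_extension_algHom_adicCompletion_apply_eq_smul`** — ∀ `σ : Γ_K`, ∃ `w : v.Extension (𝓞 F)`, ∃ `e : F_w →ₐ[K_v] K̄_v`, `e x = ι_v (σ • x)`.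
* §3 **`forall_extension_exists_pow_eq_iff_forall_exists_fixed`** / **`…_iff_forall_exists_pow_eq_one`** — the two-sided dictionary:
  «`∀ w ∣ v, x ∈ (F_w)ⁿ`» ⟺ «`∀ σ`, fixed `n`-th root of `ι_v(σ•x)` under `θ_v⁻¹(σ·Gal(K̄/F)·σ⁻¹)`» ⟺ (for `x ≠ 0`) «`∀ σ`, `μₙ`-coboundary».

References: Neukirch, *Algebraic Number Theory* (1999) II (8.1)–(8.3); Cassels–Fröhlich (1967) II §10 (10.2). beyond-print theorem: no (folklore).
-/

set_option linter.dupNamespace false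

noncomputable section

namespace Summit.BirchSwinnertonDyer.BirchSwinnertonDyer.Theorems.PrintCf2.LocalPowersAtV

/-! ## §1. Orthogonal idempotents summing to `1` in a domain -/

section Idempotents

variable {ι S : Type*} {R : ι → Type*} [DecidableEq ι] [∀ i, Semiring (R i)] [CommRing S] [IsDomain S]

/-- A ring map `Ψ : (Π i, R i) →+* S` into a domain sends exactly one of the standard idempotents `Pi.single i 1` to `1`, the others to `0` —
here: **some `i₀` has `Ψ (Pi.single i₀ 1) = 1`**. [folklore] -/
theorem exists_map_single_one_eq_one [Fintype ι] (Ψ : (Π i, R i) →+* S) : ∃ i₀ : ι, Ψ (Pi.single i₀ 1) = 1 := by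
  have hone : (∑ i, (Pi.single i 1 : Π i, R i)) = 1 := by
    ext j
    rw [Finset.sum_apply, Finset.sum_eq_single j (fun i _ hi ↦ Pi.single_eq_of_ne' hi 1) (fun h ↦ absurd (Finset.mem_univ j) h),
      Pi.single_eq_same, Pi.one_apply]
  have hsum : ∑ i, Ψ (Pi.single i 1) = 1 := by rw [← map_sum, hone, map_one]
  obtain ⟨i₀, -, hi₀⟩ := Finset.exists_ne_zero_of_sum_ne_zero (hsum.trans_ne one_ne_zero)
  refine ⟨i₀, ?_⟩
  -- `Ψ(ε)` is a non-zero idempotent of the domain `S`, hence `1`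
  have hidem : Ψ (Pi.single i₀ 1) * Ψ (Pi.single i₀ 1) = Ψ (Pi.single i₀ 1) := by
    rw [← map_mul, ← Pi.single_mul, mul_one]
  exact mul_right_cancel₀ hi₀ (hidem.trans (one_mul _).symm)

omit [IsDomain S] in
/-- For a ring map `Ψ : (Π i, R i) →+* S` and `i₀` with `Ψ (Pi.single i₀ 1) = 1`: **`Ψ y = Ψ (Pi.single i₀ (y i₀))`** — `Ψ` factors through the
`i₀`-th projection. [folklore] -/
theorem map_eq_map_single_apply (Ψ : (Π i, R i) →+* S) {i₀ : ι} (h : Ψ (Pi.single i₀ 1) = 1) (y : Π i, R i) :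
    Ψ y = Ψ (Pi.single i₀ (y i₀)) := by
  have hy : Pi.single i₀ (y i₀) = Pi.single i₀ (1 : R i₀) * y := by
    ext i
    by_cases hi : i = i₀
    · subst hi; simp
    · simp [Pi.single_eq_of_ne hi]
  rw [hy, map_mul, h, one_mul]

end Idempotents

/-! ## §2. Every `σ ∈ Γ_K` cuts out a place `w ∣ v`: `∃ w, ∃ e : F_w →ₐ[K_v] K̄_v, e|_F = ι_v ∘ σ` -/

section Converse

open scoped NumberField TensorProduct
open IsDedekindDomain Field
open Literature.NumberTheory.GaloisRepresentations Literature.NumberTheory.GaloisRepresentations.LocalWeilDatum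

variable {K : Type} [Field K] [NumberField K] (v : HeightOneSpectrum (𝓞 K))
  (F : IntermediateField K (AlgebraicClosure K)) [NumberField F] [FiniteDimensional K F]

/-- **Every conjugate `ι_v ∘ σ` of the chosen embedding cuts out a place `w ∣ v` of `F`**: for `σ ∈ Γ_K` there are `w : v.Extension (𝓞 F)` and a
`K_v`-algebra embedding `e : F_w →ₐ[K_v] K̄_v` with `e x = ι_v (σ • x)` for all `x ∈ F`. [cite: NeukirchANT1999, Ch. II §8 (8.1)–(8.3)]
[cite: CasselsFrohlichANT1967, Ch. II §10 Theorem (10.2)] -/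
theorem exists_extension_algHom_adicCompletion_apply_eq_smul (σ : absoluteGaloisGroup K) :
    ∃ (w : v.Extension (𝓞 F))
      (e : w.1.adicCompletion F →ₐ[v.adicCompletion K] AlgebraicClosure (v.adicCompletion K)),
      ∀ x : F, e (algebraMap F (w.1.adicCompletion F) x) =
        absClosureEmbedding K (v.adicCompletion K) (σ • (x : AlgebraicClosure K)) := by
  classical
  set Kv := v.adicCompletion K
  haveI : Finite (v.Extension (𝓞 F)) := HeightOneSpectrum.Extension.finite (𝓞 K) K F (𝓞 F) v
  letI : Fintype (v.Extension (𝓞 F)) := Fintype.ofFinite _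
  -- the `K`-embedding `ψ = ι_v ∘ σ|_F : F → K̄_v`
  let ψ : F →ₐ[K] AlgebraicClosure Kv :=
    { toFun := fun x ↦ absClosureEmbedding K Kv (σ • (x : AlgebraicClosure K))
      map_one' := by simp
      map_mul' := fun x y ↦ by simp [smul_mul']
      map_zero' := by simp
      map_add' := fun x y ↦ by simp [smul_add]
      commutes' := fun k ↦ by
        change absClosureEmbedding K Kv (σ • algebraMap K (AlgebraicClosure K) k) = _
        rw [smul_algebraMap, AlgHom.commutes] }
  -- extend to `F ⊗[K] K_v → K̄_v`, then to `Ψ : ∏_{w ∣ v} F_w → K̄_v` through the packet's `F ⊗[K] K_v ≅ ∏ F_w`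
  let Φ : F ⊗[K] Kv →ₐ[K] AlgebraicClosure Kv :=
    Algebra.TensorProduct.lift ψ (IsScalarTower.toAlgHom K Kv (AlgebraicClosure Kv)) fun _ _ ↦ Commute.all _ _
  let Ψ : (Π w : v.Extension (𝓞 F), w.1.adicCompletion F) →+* AlgebraicClosure Kv :=
    Φ.toRingHom.comp (HeightOneSpectrum.adicCompletion.baseChangeAlgEquiv K F (𝓞 F) v).symm.toRingHom
  have hΨ : ∀ (x : F) (c : Kv), Ψ (fun w ↦ algebraMap F (w.1.adicCompletion F) x * algebraMap Kv (w.1.adicCompletion F) c) =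
      ψ x * algebraMap Kv (AlgebraicClosure Kv) c := by
    intro x c
    have h1 : (fun w : v.Extension (𝓞 F) ↦ algebraMap F (w.1.adicCompletion F) x * algebraMap Kv (w.1.adicCompletion F) c) =
        HeightOneSpectrum.adicCompletion.baseChangeAlgEquiv K F (𝓞 F) v (x ⊗ₜ c) := by
      funext w; exact (HeightOneSpectrum.adicCompletion.baseChange_tmul_apply K F (𝓞 F) v x c w).symm
    change Φ ((HeightOneSpectrum.adicCompletion.baseChangeAlgEquiv K F (𝓞 F) v).symm _) = _
    rw [h1, AlgEquiv.symm_apply_apply]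
    exact Algebra.TensorProduct.lift_tmul _ _ _ x c
  -- the idempotent of the factor `w₀` survives
  obtain ⟨w₀, hw₀⟩ := exists_map_single_one_eq_one Ψ
  refine ⟨w₀,
    { toFun := fun t ↦ Ψ (Pi.single w₀ t)
      map_one' := hw₀
      map_mul' := fun s t ↦ by rw [← map_mul, ← Pi.single_mul]
      map_zero' := by rw [Pi.single_zero, map_zero]
      map_add' := fun s t ↦ by rw [← map_add, ← Pi.single_add]
      commutes' := fun c ↦ ?_ }, fun x ↦ ?_⟩
  · -- `K_v`-linearity: `Ψ(ε·(1 ⊗ c)) = Ψ(ε)·c = c`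
    change Ψ (Pi.single w₀ (algebraMap Kv (w₀.1.adicCompletion F) c)) = algebraMap Kv (AlgebraicClosure Kv) c
    have h1 := hΨ 1 c
    rw [map_eq_map_single_apply Ψ hw₀] at h1
    simpa only [map_one, one_mul] using h1
  · -- on `F`: `Ψ(ε·(x ⊗ 1)) = ψ x`
    change Ψ (Pi.single w₀ (algebraMap F (w₀.1.adicCompletion F) x)) = ψ x
    have h1 := hΨ x 1
    rw [map_eq_map_single_apply Ψ hw₀] at h1
    simpa only [map_one, mul_one] using h1

/-! ## §3. The two-sided dictionary: «`x ∈ (F_w)ⁿ` for all `w ∣ v`» ⟺ «fixed root / coboundary for all `σ`» -/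

/-- **«`x` is an `n`-th power in `F_w` for every `w ∣ v`» ⟺ «for every `σ ∈ Γ_K`, `ι_v(σ•x)` has an `n`-th root in `K̄_v` fixed by
`θ_v⁻¹(σ·Gal(K̄/F)·σ⁻¹)`»** (both directions of Neukirch II (8.1)–(8.3)). [cite: NeukirchANT1999, Ch. II §8 (8.1)–(8.3)] -/
theorem forall_extension_exists_pow_eq_iff_forall_exists_fixed (x : F) (n : ℕ) :
    (∀ w : v.Extension (𝓞 F), ∃ y : w.1.adicCompletion F, y ^ n = algebraMap F (w.1.adicCompletion F) x) ↔
      ∀ σ : absoluteGaloisGroup K, ∃ z : AlgebraicClosure (v.adicCompletion K),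
        (∀ τ : absoluteGaloisGroup (v.adicCompletion K),
            σ⁻¹ * absGaloisRestrict K (v.adicCompletion K) τ * σ ∈ galFixing K F → τ • z = z) ∧
          z ^ n = absClosureEmbedding K (v.adicCompletion K) (σ • (x : AlgebraicClosure K)) := by
  refine ⟨fun h σ ↦ ?_, forall_extension_exists_pow_eq_of_forall_exists_fixed v F x n⟩
  obtain ⟨w, e, he⟩ := exists_extension_algHom_adicCompletion_apply_eq_smul v F σ
  exact (exists_pow_eq_adicCompletion_iff_exists_fixed_pow_eq v F w he x n).1 (h w)

/-- **Coboundary form of the dictionary** (`x ≠ 0`): «`x ∈ (F_w)ⁿ` for every `w ∣ v`» ⟺ «for every `σ` there are `α`, `ζ` with `αⁿ = ι_v(σ•x)`,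
`ζⁿ = 1` and `τα·α⁻¹ = τζ·ζ⁻¹` for all `τ ∈ θ_v⁻¹(σ·Gal(K̄/F)·σ⁻¹)`». [cite: SerreLocalFields1979, X §3 b)] [cite: NeukirchANT1999, Ch. II §8 (8.1)–(8.3)] -/
theorem forall_extension_exists_pow_eq_iff_forall_exists_pow_eq_one {x : F} (hx : x ≠ 0) (n : ℕ) :
    (∀ w : v.Extension (𝓞 F), ∃ y : w.1.adicCompletion F, y ^ n = algebraMap F (w.1.adicCompletion F) x) ↔
      ∀ σ : absoluteGaloisGroup K, ∃ α ζ : AlgebraicClosure (v.adicCompletion K),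
        α ^ n = absClosureEmbedding K (v.adicCompletion K) (σ • (x : AlgebraicClosure K)) ∧ ζ ^ n = 1 ∧
          ∀ τ : absoluteGaloisGroup (v.adicCompletion K),
            σ⁻¹ * absGaloisRestrict K (v.adicCompletion K) τ * σ ∈ galFixing K F → τ • α * α⁻¹ = τ • ζ * ζ⁻¹ := by
  refine ⟨fun h σ ↦ ?_, forall_extension_exists_pow_eq_of_forall_exists_pow_eq_one v F hx n⟩
  obtain ⟨w, e, he⟩ := exists_extension_algHom_adicCompletion_apply_eq_smul v F σ
  -- an `n`-th root `α` of `ι_v(σ•x)` exists in the algebraically closed `K̄_v`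
  obtain ⟨α, hα⟩ : ∃ α : AlgebraicClosure (v.adicCompletion K),
      α ^ n = absClosureEmbedding K (v.adicCompletion K) (σ • (x : AlgebraicClosure K)) := by
    rcases Nat.eq_zero_or_pos n with hn | hn
    · obtain ⟨y, hy⟩ := h w
      subst hn
      refine ⟨1, ?_⟩
      rw [pow_zero] at hy ⊢
      rw [← he x, ← hy, map_one]
    · exact IsAlgClosed.exists_pow_nat_eq _ hn
  obtain ⟨ζ, hζ, hcob⟩ := (exists_pow_eq_adicCompletion_iff_exists_pow_eq_one v F w he hx hα).1 (h w)
  exact ⟨α, ζ, hα, hζ, hcob⟩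

end Converse

end Summit.BirchSwinnertonDyer.BirchSwinnertonDyer.Theorems.PrintCf2.LocalPowersAtV
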